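import Literature.AlgebraicGeometry.Motives.AbelianVarietyLatticeTensorEquivariantHom
import Literature.AlgebraicGeometry.Motives.AbelianVarietyInvariantHomRank
import HarnessLib

/-!
# `ℓ`-adic equivariant homomorphisms of lattice tensors:
# `|G| · rk Hom_{ℤ_ℓ[G]}(T_ℓ(Y ⊗ M), T_ℓ(Y' ⊗ N)) = (Σ_g tr m(g⁻¹) tr n(g)) · 2 dim Y · 2 dim Y'`, the ratio
# `rk_ℤ Hom_G(Y ⊗ M, Y' ⊗ N) · 4 dim Y dim Y' = rk Hom_{ℤ_ℓ[G]} · rk_ℤ Hom(Y, Y')`, and THE INHERITED TATE PROPERTY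

Sequel of `Motives/AbelianVarietyLatticeTensorEquivariantHom`.  For lattice tensors `X = Y ⊗ M` (bicone `b` over `ι`, integral matrix
representation `m`, twist `β`, action `ρ`: `ι_j ρ(g) π_i = m(g)_{ij} • β(g)`) and `X' = Y' ⊗ N` (`c`, `n`, `β'`, `ρ'`) of a finite group
`G` over a field `K`, and a prime `ℓ` invertible in `K`, Mazur–Rubin–Silverberg Thm. 2.2 (iii) — `T_ℓ(I ⊗ V) ≅ I ⊗ T_ℓ(V)`
equivariantly — makes the `ℤ_ℓ[G]`-module `Hom(T_ℓ X, T_ℓ X')` the tensor product `M^∨ ⊗ N ⊗ Hom(T_ℓ Y, T_ℓ Y')`, so that the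
`ℓ`-adic inner product `|G| · rk Hom_{ℤ_ℓ[G]}(T_ℓ X, T_ℓ X') = Σ_g χ_{X'}(g) χ_X(g⁻¹)` of `Motives/AbelianVarietyEquivariantHomCharacterBound`
evaluates through the characters `χ_X = tr m · χ_β` of `Motives/AbelianVarietyLatticeTensor` §2:

* §1 **`|G| · rk_{ℤ_ℓ} Hom_{ℤ_ℓ[G]}(T_ℓ(Y ⊗_β M), T_ℓ(Y' ⊗_{β'} N)) = Σ_g tr n(g) χ_{β'}(g) · tr m(g⁻¹) χ_β(g⁻¹)`**
  (`card_mul_finrank_equivariantTateHom_eq_sum_trace_mul`) and, untwisted, **`= (Σ_g tr m(g⁻¹) tr n(g)) · 2 dim Y · 2 dim Y'`**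
  (`card_mul_finrank_equivariantTateHom_eq_mul_dim`), i.e. `rk = d · 4 dim Y dim Y'` for `|G| d = Σ_g tr m(g⁻¹) tr n(g)` (`d = rk Hom_{ℤ[G]}(M, N)`;
  Serre §7.3 / Ex. 2.6 (b): `⟨χ_M, χ_N⟩ = dim Hom_G`); the one-sided counts against an arbitrary action `σ` on `X`:
  `|G| · rk Hom_{ℤ_ℓ[G]}(T_ℓ X, T_ℓ(Y' ⊗ N)) = Σ_g tr n(g) χ_{β'}(g) χ_X(g⁻¹)` and symmetrically;
* §2 against the EXACT ALGEBRAIC COUNT `|G| · rk_ℤ Hom_G(Y ⊗ M, Y' ⊗ N) = (Σ_g tr m(g⁻¹) tr n(g)) · rk_ℤ Hom(Y, Y')` of the prequel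
  (MRS Prop. 1.6 (ii)): **`rk_ℤ Hom_G(Y ⊗ M, Y' ⊗ N) · 4 dim Y dim Y' = rk_{ℤ_ℓ} Hom_{ℤ_ℓ[G]}(T_ℓ(Y ⊗ M), T_ℓ(Y' ⊗ N)) · rk_ℤ Hom(Y, Y')`**
  (`finrank_equivariantHom_mul_eq`) — the defect in Mumford's injection `ℤ_ℓ ⊗ Hom_G ↪ Hom_{ℤ_ℓ[G]}(T_ℓ, T_ℓ)` (§19 Thm. 3; the tree's
  `finrank_equivariantHom_le`) for the pair of lattice tensors IS the defect for the pair `(Y, Y')`; hence THE INHERITED TATE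
  PROPERTY: **if `rk_ℤ Hom(Y, Y') = 4 dim Y dim Y'`** (the conclusion of Tate's isogeny theorem for `(Y, Y')` — over finite fields
  Tate 1966, over number fields Faltings 1983 — taken as a HYPOTHESIS, nothing asserted) **then
  `rk_ℤ Hom_G(Y ⊗ M, Y' ⊗ N) = rk_{ℤ_ℓ} Hom_{ℤ_ℓ[G]}(T_ℓ(Y ⊗ M), T_ℓ(Y' ⊗ N))` for ALL lattices `M`, `N`**
  (`finrank_equivariantHom_eq_finrank_equivariantTateHom`; Milne 1986 §12 p. 122: the rank count along a decomposition);
* §2′ the ONE-SIDED ALGEBRAIC COUNTS over any field: **`|G| · rk_ℤ Hom_G(X, Y' ⊗_{β'} N) = Σ_g tr n(g) · tr(f ↦ σ(g⁻¹) f β'(g) | Hom(X, Y'))`**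
  for an arbitrary action `σ` on `X` (`card_mul_finrank_equivariantHom_target_eq_sum`; untwisted: `Σ_g tr n(g) tr(f ↦ σ(g⁻¹) f)`), and the
  source form `|G| · rk_ℤ Hom_G(Y ⊗_β M, X') = Σ_g tr m(g⁻¹) tr(f ↦ β(g⁻¹) f σ'(g) | Hom(Y, X'))`, from the prequel's
  `|G| rk Hom_G(X, X') = Σ_g tr(f ↦ σ(g⁻¹) f σ'(g))` and the one-sided characters `tr(f ↦ A f B | Hom(X, Y'^κ)) = tr(b) tr(f ↦ A f ψ)`
  (`trace_leftComp_rightComp_eq_of_blocks_right/left`, the two-sided character of the prequel with a one-point bicone);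
* §3 invariant maps: **`rk_{ℤ_ℓ} {f : T_ℓ(Y ⊗ M) → T_ℓ Z | f ∘ T_ℓ ρ(g) = f} = 4 · d dim Y · dim Z`** for `|G| d = Σ_g tr m(g)`
  (`d = rank M^G`; maps out of the coinvariants `T_ℓ(Y ⊗ M)_G`, of rank `2 dim B_G(Y ⊗ M) = 2 d dim Y` by the prequel's
  `dim_image_normG_eq_of_card_mul_eq`), the target form `rk {f : T_ℓ X → T_ℓ(Y' ⊗ N) | T_ℓ ρ'(g) ∘ f = f} = 4 · dim X · d dim Y'`, and the
  Hom-side bounds `rk_ℤ {f : Y ⊗ M → Z | ρ(g) f = f} ≤ 4 d dim Y dim Z`, `rk_ℤ {f : X → Y' ⊗ N | f ρ'(g) = f} ≤ 4 dim X · d dim Y'`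
  (`Motives/AbelianVarietyInvariantHomRank` specialised).

Everything is a theorem; `Hom_{ℤ_ℓ[G]}`, `Hom_G` are the `⨅_g eqLocus` submodules of `Motives/AbelianVarietyEquivariantHomCharacterBound`;
no Tate conjecture is used or asserted (it enters §2 only as an explicit hypothesis on `(Y, Y')`).

## References

* [MazurRubinSilverberg2007] B. Mazur, K. Rubin, A. Silverberg, *Twisting commutative algebraic groups*, J. Algebra 314 (2007)
  419–438: Prop. 1.6 (i), (ii) (`Hom_{𝒪[G_k]}(I, J) ⊗ Hom_k(V, W) ↪ Hom_k(I ⊗ V, J ⊗ W)`), Thm. 2.2 (iii) (`T_ℓ(I ⊗_𝒪 V) ≅ I ⊗_𝒪 T_ℓ(V)`,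
  `G_k`-equivariantly).  Held: `paper:doi-10-1016-j-jalgebra-2007-02-052`, PDF pp. 4–6 read 2026-08-28.
* [SerreLinearRepresentations1977] J.-P. Serre, *Linear Representations of Finite Groups*, GTM 42 (1977): §2.1 Prop. 2 (ii), §2.3
  Ex. 2.6 (b) and §7.3 (`⟨φ, ψ⟩ = dim Hom_G(V, W)`), Ex. 2.4 (the character `χ₁* χ₂` of `Hom(V₁, V₂)`, PDF p. 16).
* [MumfordAV1970] D. Mumford, *Abelian Varieties* (1970), §19 Thm. 3 and Cor. 1 (pp. 176–178: `ℤ_ℓ ⊗ Hom(X, Y) ↪ Hom(T_ℓ X, T_ℓ Y)`,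
  `rk Hom(X, Y) ≤ 4 dim X dim Y`), Thm. 4 (p. 180).
* [Milne1986AbelianVarieties] J. S. Milne, *Abelian varieties*, in Cornell–Silverman (1986), §12 Lemma 12.2, Thm. 12.5 (pp. 189–190),
  and the rank count p. 122.
* [Tate1966Endomorphisms] J. Tate, *Endomorphisms of abelian varieties over finite fields*, Invent. Math. 2 (1966) 134–144, Main Theorem
  (`ℤ_ℓ ⊗ Hom_k(A, B) ≅ Hom_{Gal}(T_ℓ A, T_ℓ B)` over a finite field) — cited for the HYPOTHESIS of §2 only.
* [LangeRodriguez2022] H. Lange, R. E. Rodríguez, *Decomposition of Jacobians by Prym Varieties*, LNM 2310 (2022), §2.7 (2.18)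
  (`dim Hom_G` as an inner product of characters), §2.9.1 Prop. 2.9.3 (PDF p. 46).
* [KaniRosen1989] E. Kani, M. Rosen, *Idempotent relations and factors of Jacobians*, Math. Ann. 284 (1989), §3 Thm. B.
-/

noncomputable section

open CategoryTheory CategoryTheory.Limits
open Literature.NumberTheory.DiophantineGeometry
open Literature.RepresentationTheory.FiniteGroups

universe u

namespace Literature.AlgebraicGeometry.Motives

namespace AbelianVariety

namespace LatticeTensor

variable {K : Type u} [Field K] (ℓ : ℕ) [Fact ℓ.Prime]

/-! ## §1 `|G| · rk Hom_{ℤ_ℓ[G]}(T_ℓ(Y ⊗ M), T_ℓ(Y' ⊗ N)) = Σ_g tr n(g) χ_{β'}(g) tr m(g⁻¹) χ_β(g⁻¹)` -/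

section TateHom

variable {Y Y' : AbelianVariety K} {ι κ : Type} [Fintype ι] [Fintype κ] [DecidableEq ι] [DecidableEq κ]
  (b : Bicone (fun _ : ι ↦ Y)) (c : Bicone (fun _ : κ ↦ Y')) {G : Type} [Group G] [Fintype G]
  (m : G →* Matrix ι ι ℤ) (n : G →* Matrix κ κ ℤ) (β : G →* End Y) (β' : G →* End Y')
  (ρ : G →* End b.pt) (ρ' : G →* End c.pt)

/-- **`|G| · rk_{ℤ_ℓ} Hom_{ℤ_ℓ[G]}(T_ℓ(Y ⊗_β M), T_ℓ(Y' ⊗_{β'} N)) = Σ_g (tr n(g) · χ_{β'}(g)) · (tr m(g⁻¹) · χ_β(g⁻¹))`** (`ℓ` invertible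
in `K`): the `ℓ`-adic inner product `Σ_g χ_{X'}(g) χ_X(g⁻¹)` of the characters `χ_X = tr m · χ_β`, `χ_{X'} = tr n · χ_{β'}` of the two
lattice tensors (`T_ℓ(I ⊗ V) ≅ I ⊗ T_ℓ V`). [cite: MazurRubinSilverberg2007, Thm. 2.2 (iii) and Prop. 1.6]
[cite: SerreLinearRepresentations1977, §2.1 Prop. 2 (ii), §2.3 and §7.3] [cite: MumfordAV1970, §19 Thm. 3 (p. 176)] -/
theorem card_mul_finrank_equivariantTateHom_eq_sum_trace_mul (hb : ∑ j, b.π j ≫ b.ι j = 𝟙 b.pt) (hc : ∑ k, c.π k ≫ c.ι k = 𝟙 c.pt)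
    (hρ : ∀ (g : G) (i j : ι), b.ι j ≫ End.asHom (ρ g) ≫ b.π i = m g i j • End.asHom (β g))
    (hρ' : ∀ (g : G) (k l : κ), c.ι l ≫ End.asHom (ρ' g) ≫ c.π k = n g k l • End.asHom (β' g)) (hℓ : (ℓ : K) ≠ 0) :
    (Fintype.card G : ℤ_[ℓ]) * Module.finrank ℤ_[ℓ]
        (⨅ g : G, LinearMap.eqLocus (LinearMap.llcomp ℤ_[ℓ] _ _ _ (tateModuleMap ℓ (End.asHom (ρ' g))))
          (LinearMap.lcomp ℤ_[ℓ] _ (tateModuleMap ℓ (End.asHom (ρ g)))) :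
            Submodule ℤ_[ℓ] (b.pt.tateModule ℓ →ₗ[ℤ_[ℓ]] c.pt.tateModule ℓ)) =
      ∑ g, ((n g).trace : ℤ_[ℓ]) * LinearMap.trace ℤ_[ℓ] (Y'.tateModule ℓ) (tateModuleMap ℓ (End.asHom (β' g))) *
        (((m g⁻¹).trace : ℤ_[ℓ]) * LinearMap.trace ℤ_[ℓ] (Y.tateModule ℓ) (tateModuleMap ℓ (End.asHom (β g⁻¹)))) := by
  rw [AbelianVariety.card_mul_finrank_equivariantTateHom_eq_sum ℓ ρ ρ' hℓ]
  exact Finset.sum_congr rfl fun g _ ↦ by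
    rw [trace_tateModuleMap_asHom_eq_trace_mul ℓ c n β' ρ' hc hρ' hℓ g,
      trace_tateModuleMap_asHom_eq_trace_mul ℓ b m β ρ hb hρ hℓ g⁻¹]

/-- **`|G| · rk_{ℤ_ℓ} Hom_{ℤ_ℓ[G]}(T_ℓ(Y ⊗ M), T_ℓ(Y' ⊗ N)) = (Σ_g tr m(g⁻¹) tr n(g)) · 2 dim Y · 2 dim Y'`** for the untwisted tensors
(`ι_j ρ(g) π_i = m(g)_{ij} • 𝟙`, `ι_l ρ'(g) π_k = n(g)_{kl} • 𝟙`; `ℓ` invertible in `K`): `Hom_{ℤ_ℓ[G]}(M ⊗ T_ℓ Y, N ⊗ T_ℓ Y') =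
Hom_{ℤ[G]}(M, N) ⊗ Hom(T_ℓ Y, T_ℓ Y')` up to finite index, `Σ_g χ_M(g⁻¹) χ_N(g) = |G| · rk Hom_{ℤ[G]}(M, N)`.
[cite: MazurRubinSilverberg2007, Thm. 2.2 (iii) and Prop. 1.6 (ii)] [cite: SerreLinearRepresentations1977, §2.3 Ex. 2.6 (b) and §7.3]
[cite: MumfordAV1970, §19 Thm. 4 (p. 180)] -/
theorem card_mul_finrank_equivariantTateHom_eq_mul_dim (hb : ∑ j, b.π j ≫ b.ι j = 𝟙 b.pt) (hc : ∑ k, c.π k ≫ c.ι k = 𝟙 c.pt)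
    (hρ₁ : ∀ (g : G) (i j : ι), b.ι j ≫ End.asHom (ρ g) ≫ b.π i = m g i j • 𝟙 Y)
    (hρ'₁ : ∀ (g : G) (k l : κ), c.ι l ≫ End.asHom (ρ' g) ≫ c.π k = n g k l • 𝟙 Y') (hℓ : (ℓ : K) ≠ 0) :
    (Fintype.card G : ℤ_[ℓ]) * Module.finrank ℤ_[ℓ]
        (⨅ g : G, LinearMap.eqLocus (LinearMap.llcomp ℤ_[ℓ] _ _ _ (tateModuleMap ℓ (End.asHom (ρ' g))))
          (LinearMap.lcomp ℤ_[ℓ] _ (tateModuleMap ℓ (End.asHom (ρ g)))) :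
            Submodule ℤ_[ℓ] (b.pt.tateModule ℓ →ₗ[ℤ_[ℓ]] c.pt.tateModule ℓ)) =
      ((∑ g, (m g⁻¹).trace * (n g).trace : ℤ) : ℤ_[ℓ]) * ((2 * Y.dim : ℕ) : ℤ_[ℓ]) * ((2 * Y'.dim : ℕ) : ℤ_[ℓ]) := by
  rw [AbelianVariety.card_mul_finrank_equivariantTateHom_eq_sum ℓ ρ ρ' hℓ]
  simp_rw [trace_tateModuleMap_asHom_eq_trace_mul_dim ℓ c n ρ' hc hρ'₁ hℓ,
    trace_tateModuleMap_asHom_eq_trace_mul_dim ℓ b m ρ hb hρ₁ hℓ]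
  push_cast
  rw [Finset.sum_mul, Finset.sum_mul]
  exact Finset.sum_congr rfl fun g _ ↦ by ring

/-- **`rk_{ℤ_ℓ} Hom_{ℤ_ℓ[G]}(T_ℓ(Y ⊗ M), T_ℓ(Y' ⊗ N)) = d · 2 dim Y · 2 dim Y'` whenever `|G| · d = Σ_g tr m(g⁻¹) tr n(g)`**
(`d = rk Hom_{ℤ[G]}(M, N)`; untwisted tensors, `ℓ` invertible in `K`). [cite: MazurRubinSilverberg2007, Thm. 2.2 (iii) and Prop. 1.6 (ii)]
[cite: SerreLinearRepresentations1977, §7.3 (`⟨φ, ψ⟩ = dim Hom_G`)] -/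
theorem finrank_equivariantTateHom_eq_of_card_mul_eq (hb : ∑ j, b.π j ≫ b.ι j = 𝟙 b.pt) (hc : ∑ k, c.π k ≫ c.ι k = 𝟙 c.pt)
    (hρ₁ : ∀ (g : G) (i j : ι), b.ι j ≫ End.asHom (ρ g) ≫ b.π i = m g i j • 𝟙 Y)
    (hρ'₁ : ∀ (g : G) (k l : κ), c.ι l ≫ End.asHom (ρ' g) ≫ c.π k = n g k l • 𝟙 Y') (hℓ : (ℓ : K) ≠ 0) {d : ℕ}
    (hd : (Fintype.card G : ℤ) * d = ∑ g, (m g⁻¹).trace * (n g).trace) :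
    Module.finrank ℤ_[ℓ]
        (⨅ g : G, LinearMap.eqLocus (LinearMap.llcomp ℤ_[ℓ] _ _ _ (tateModuleMap ℓ (End.asHom (ρ' g))))
          (LinearMap.lcomp ℤ_[ℓ] _ (tateModuleMap ℓ (End.asHom (ρ g)))) :
            Submodule ℤ_[ℓ] (b.pt.tateModule ℓ →ₗ[ℤ_[ℓ]] c.pt.tateModule ℓ)) =
      d * (2 * Y.dim) * (2 * Y'.dim) := by
  have h := card_mul_finrank_equivariantTateHom_eq_mul_dim ℓ b c m n ρ ρ' hb hc hρ₁ hρ'₁ hℓ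
  rw [← hd] at h
  have hG : (Fintype.card G : ℤ_[ℓ]) ≠ 0 := Nat.cast_ne_zero.2 Fintype.card_ne_zero
  refine Nat.cast_injective (R := ℤ_[ℓ]) (mul_left_cancel₀ hG ?_)
  push_cast at h ⊢
  linear_combination h

/-- One-sided form, target a lattice tensor: **`|G| · rk Hom_{ℤ_ℓ[G]}(T_ℓ X, T_ℓ(Y' ⊗_{β'} N)) = Σ_g tr n(g) χ_{β'}(g) · χ_X(g⁻¹)`** for an
arbitrary action `σ` on `X`. [cite: MazurRubinSilverberg2007, Thm. 2.2 (iii)] [cite: SerreLinearRepresentations1977, §2.3 and §7.3] -/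
theorem card_mul_finrank_equivariantTateHom_target_eq_sum {X : AbelianVariety K} (σ : G →* End X)
    (hc : ∑ k, c.π k ≫ c.ι k = 𝟙 c.pt)
    (hρ' : ∀ (g : G) (k l : κ), c.ι l ≫ End.asHom (ρ' g) ≫ c.π k = n g k l • End.asHom (β' g)) (hℓ : (ℓ : K) ≠ 0) :
    (Fintype.card G : ℤ_[ℓ]) * Module.finrank ℤ_[ℓ]
        (⨅ g : G, LinearMap.eqLocus (LinearMap.llcomp ℤ_[ℓ] _ _ _ (tateModuleMap ℓ (End.asHom (ρ' g))))
          (LinearMap.lcomp ℤ_[ℓ] _ (tateModuleMap ℓ (End.asHom (σ g)))) :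
            Submodule ℤ_[ℓ] (X.tateModule ℓ →ₗ[ℤ_[ℓ]] c.pt.tateModule ℓ)) =
      ∑ g, ((n g).trace : ℤ_[ℓ]) * LinearMap.trace ℤ_[ℓ] (Y'.tateModule ℓ) (tateModuleMap ℓ (End.asHom (β' g))) *
        LinearMap.trace ℤ_[ℓ] (X.tateModule ℓ) (tateModuleMap ℓ (End.asHom (σ g⁻¹))) := by
  rw [AbelianVariety.card_mul_finrank_equivariantTateHom_eq_sum ℓ σ ρ' hℓ]
  exact Finset.sum_congr rfl fun g _ ↦ by rw [trace_tateModuleMap_asHom_eq_trace_mul ℓ c n β' ρ' hc hρ' hℓ g]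

/-- One-sided form, source a lattice tensor: **`|G| · rk Hom_{ℤ_ℓ[G]}(T_ℓ(Y ⊗_β M), T_ℓ X') = Σ_g χ_{X'}(g) · tr m(g⁻¹) χ_β(g⁻¹)`** for an
arbitrary action `σ'` on `X'`. [cite: MazurRubinSilverberg2007, Thm. 2.2 (iii)] [cite: SerreLinearRepresentations1977, §2.3 and §7.3] -/
theorem card_mul_finrank_equivariantTateHom_source_eq_sum {X' : AbelianVariety K} (σ' : G →* End X')
    (hb : ∑ j, b.π j ≫ b.ι j = 𝟙 b.pt)
    (hρ : ∀ (g : G) (i j : ι), b.ι j ≫ End.asHom (ρ g) ≫ b.π i = m g i j • End.asHom (β g)) (hℓ : (ℓ : K) ≠ 0) :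
    (Fintype.card G : ℤ_[ℓ]) * Module.finrank ℤ_[ℓ]
        (⨅ g : G, LinearMap.eqLocus (LinearMap.llcomp ℤ_[ℓ] _ _ _ (tateModuleMap ℓ (End.asHom (σ' g))))
          (LinearMap.lcomp ℤ_[ℓ] _ (tateModuleMap ℓ (End.asHom (ρ g)))) :
            Submodule ℤ_[ℓ] (b.pt.tateModule ℓ →ₗ[ℤ_[ℓ]] X'.tateModule ℓ)) =
      ∑ g, LinearMap.trace ℤ_[ℓ] (X'.tateModule ℓ) (tateModuleMap ℓ (End.asHom (σ' g))) *
        (((m g⁻¹).trace : ℤ_[ℓ]) * LinearMap.trace ℤ_[ℓ] (Y.tateModule ℓ) (tateModuleMap ℓ (End.asHom (β g⁻¹)))) := by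
  rw [AbelianVariety.card_mul_finrank_equivariantTateHom_eq_sum ℓ ρ σ' hℓ]
  exact Finset.sum_congr rfl fun g _ ↦ by rw [trace_tateModuleMap_asHom_eq_trace_mul ℓ b m β ρ hb hρ hℓ g⁻¹]

/-! ## §2 `rk_ℤ Hom_G · 4 dim Y dim Y' = rk Hom_{ℤ_ℓ[G]} · rk_ℤ Hom(Y, Y')` and the inherited Tate property -/

/-- **THE TATE RATIO IS INHERITED: `rk_ℤ Hom_G(Y ⊗ M, Y' ⊗ N) · (4 dim Y dim Y') = rk_{ℤ_ℓ} Hom_{ℤ_ℓ[G]}(T_ℓ(Y ⊗ M), T_ℓ(Y' ⊗ N)) ·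
rk_ℤ Hom(Y, Y')`** for untwisted lattice tensors of a finite group over any field (`ℓ` invertible in `K`): both sides are
`|G|⁻¹ (Σ_g tr m(g⁻¹) tr n(g))` times `rk Hom(Y, Y') · 4 dim Y dim Y'` — the algebraic count `|G| rk Hom_G = (Σ …) rk Hom(Y, Y')`
(MRS Prop. 1.6 (ii), the prequel) against the `ℓ`-adic count of §1 (MRS Thm. 2.2 (iii)).  Mumford's `rk Hom(Y, Y') ≤ 4 dim Y dim Y'`
and `rk Hom_G ≤ rk Hom_{ℤ_ℓ[G]}` are the two inequalities this identity aligns. [cite: MazurRubinSilverberg2007, Prop. 1.6 (ii) and Thm. 2.2 (iii)]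
[cite: MumfordAV1970, §19 Thm. 3 and Cor. 1 (pp. 176–178)] [cite: Milne1986AbelianVarieties, §12 Lemma 12.2, Thm. 12.5 (pp. 189–190)] -/
theorem finrank_equivariantHom_mul_eq (hb : ∑ j, b.π j ≫ b.ι j = 𝟙 b.pt) (hc : ∑ k, c.π k ≫ c.ι k = 𝟙 c.pt)
    (hρ₁ : ∀ (g : G) (i j : ι), b.ι j ≫ End.asHom (ρ g) ≫ b.π i = m g i j • 𝟙 Y)
    (hρ'₁ : ∀ (g : G) (k l : κ), c.ι l ≫ End.asHom (ρ' g) ≫ c.π k = n g k l • 𝟙 Y') (hℓ : (ℓ : K) ≠ 0) :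
    Module.finrank ℤ (⨅ g : G, LinearMap.eqLocus (Preadditive.leftComp c.pt (End.asHom (ρ g))).toIntLinearMap
        (Preadditive.rightComp b.pt (End.asHom (ρ' g))).toIntLinearMap : Submodule ℤ (b.pt ⟶ c.pt)) * (4 * Y.dim * Y'.dim) =
      Module.finrank ℤ_[ℓ]
          (⨅ g : G, LinearMap.eqLocus (LinearMap.llcomp ℤ_[ℓ] _ _ _ (tateModuleMap ℓ (End.asHom (ρ' g))))
            (LinearMap.lcomp ℤ_[ℓ] _ (tateModuleMap ℓ (End.asHom (ρ g)))) :
              Submodule ℤ_[ℓ] (b.pt.tateModule ℓ →ₗ[ℤ_[ℓ]] c.pt.tateModule ℓ)) *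
        Module.finrank ℤ (Y ⟶ Y') := by
  have h5 := congrArg (Int.cast : ℤ → ℤ_[ℓ]) (card_mul_finrank_equivariantHom_eq b c m n ρ ρ' hb hc hρ₁ hρ'₁)
  have hT := card_mul_finrank_equivariantTateHom_eq_mul_dim ℓ b c m n ρ ρ' hb hc hρ₁ hρ'₁ hℓ
  have hG : (Fintype.card G : ℤ_[ℓ]) ≠ 0 := Nat.cast_ne_zero.2 Fintype.card_ne_zero
  refine Nat.cast_injective (R := ℤ_[ℓ]) (mul_left_cancel₀ hG ?_)
  push_cast at h5 hT ⊢
  linear_combination (4 * (Y.dim : ℤ_[ℓ]) * (Y'.dim : ℤ_[ℓ])) * h5 - (Module.finrank ℤ (Y ⟶ Y') : ℤ_[ℓ]) * hT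

/-- **THE INHERITED TATE PROPERTY.**  If the pair `(Y, Y')` satisfies **`rk_ℤ Hom(Y, Y') = 4 dim Y dim Y'`** (i.e. Mumford's injection
`ℤ_ℓ ⊗ Hom(Y, Y') ↪ Hom_{ℤ_ℓ}(T_ℓ Y, T_ℓ Y')` is of full rank — the conclusion of Tate's theorem where it holds, here a hypothesis), then
for ALL untwisted lattice tensors and any finite group
**`rk_ℤ Hom_G(Y ⊗ M, Y' ⊗ N) = rk_{ℤ_ℓ} Hom_{ℤ_ℓ[G]}(T_ℓ(Y ⊗ M), T_ℓ(Y' ⊗ N))`**: the equivariant `ℓ`-adic homomorphisms of the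
twists are all algebraic up to finite index (from the ratio identity; in the degenerate case `dim Y dim Y' = 0` both ranks vanish by
§1 and `rk Hom_G ≤ rk Hom_{ℤ_ℓ[G]}`). [cite: MazurRubinSilverberg2007, Prop. 1.6 (ii) and Thm. 2.2 (iii)] [cite: Tate1966Endomorphisms, Main Theorem]
[cite: MumfordAV1970, §19 Thm. 3 (pp. 176–178)] [cite: Milne1986AbelianVarieties, §12 Thm. 12.5 and p. 122] -/
theorem finrank_equivariantHom_eq_finrank_equivariantTateHom (hb : ∑ j, b.π j ≫ b.ι j = 𝟙 b.pt)
    (hc : ∑ k, c.π k ≫ c.ι k = 𝟙 c.pt)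
    (hρ₁ : ∀ (g : G) (i j : ι), b.ι j ≫ End.asHom (ρ g) ≫ b.π i = m g i j • 𝟙 Y)
    (hρ'₁ : ∀ (g : G) (k l : κ), c.ι l ≫ End.asHom (ρ' g) ≫ c.π k = n g k l • 𝟙 Y') (hℓ : (ℓ : K) ≠ 0)
    (hYY' : Module.finrank ℤ (Y ⟶ Y') = 4 * Y.dim * Y'.dim) :
    Module.finrank ℤ (⨅ g : G, LinearMap.eqLocus (Preadditive.leftComp c.pt (End.asHom (ρ g))).toIntLinearMap
        (Preadditive.rightComp b.pt (End.asHom (ρ' g))).toIntLinearMap : Submodule ℤ (b.pt ⟶ c.pt)) =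
      Module.finrank ℤ_[ℓ]
        (⨅ g : G, LinearMap.eqLocus (LinearMap.llcomp ℤ_[ℓ] _ _ _ (tateModuleMap ℓ (End.asHom (ρ' g))))
          (LinearMap.lcomp ℤ_[ℓ] _ (tateModuleMap ℓ (End.asHom (ρ g)))) :
            Submodule ℤ_[ℓ] (b.pt.tateModule ℓ →ₗ[ℤ_[ℓ]] c.pt.tateModule ℓ)) := by
  have h := finrank_equivariantHom_mul_eq ℓ b c m n ρ ρ' hb hc hρ₁ hρ'₁ hℓ
  rw [hYY'] at h
  rcases Nat.eq_zero_or_pos (4 * Y.dim * Y'.dim) with ht | ht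
  · have hT := card_mul_finrank_equivariantTateHom_eq_mul_dim ℓ b c m n ρ ρ' hb hc hρ₁ hρ'₁ hℓ
    have h0 : ((2 * Y.dim : ℕ) : ℤ_[ℓ]) * ((2 * Y'.dim : ℕ) : ℤ_[ℓ]) = 0 := by
      rw [← Nat.cast_mul, show 2 * Y.dim * (2 * Y'.dim) = 4 * Y.dim * Y'.dim by ring, ht, Nat.cast_zero]
    rw [mul_assoc, h0, mul_zero, mul_eq_zero] at hT
    have hG : (Fintype.card G : ℤ_[ℓ]) ≠ 0 := Nat.cast_ne_zero.2 Fintype.card_ne_zero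
    have hb0 := Nat.cast_eq_zero.1 (hT.resolve_left hG)
    have hle := finrank_equivariantHom_le ℓ ρ ρ' hℓ
    omega
  · exact Nat.eq_of_mul_eq_mul_right ht h

end TateHom

/-! ## §2′ One-sided algebraic counts: `|G| · rk_ℤ Hom_G(X, Y' ⊗ N) = Σ_g tr n(g) · tr(f ↦ σ(g⁻¹) f β'(g) | Hom(X, Y'))` -/

section OneSided

variable {Y Y' : AbelianVariety K} {ι κ : Type} [Fintype ι] [Fintype κ] [DecidableEq ι] [DecidableEq κ]
  (b : Bicone (fun _ : ι ↦ Y)) (c : Bicone (fun _ : κ ↦ Y')) {G : Type} [Group G] [Fintype G]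
  (m : G →* Matrix ι ι ℤ) (n : G →* Matrix κ κ ℤ) (β : G →* End Y) (β' : G →* End Y')
  (ρ : G →* End b.pt) (ρ' : G →* End c.pt)

omit [DecidableEq κ] in
/-- **One-sided character on a power (target)**: for ANY `A : X → X` and `B ∈ End(Y'^κ)` with scalar blocks `ι_l ≫ B ≫ π_k = b_{kl} • ψ`,
`tr(f ↦ A ≫ f ≫ B | Hom(X, Y'^κ)) = tr(b) · tr(f ↦ A ≫ f ≫ ψ | Hom(X, Y'))` — the two-sided character of the prequel with the
one-point bicone on `X`. [cite: MazurRubinSilverberg2007, Prop. 1.6 (i)] [cite: SerreLinearRepresentations1977, §2.1 Prop. 2 (ii) and Ex. 2.4 (PDF p. 16)] -/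
theorem trace_leftComp_rightComp_eq_of_blocks_right {X : AbelianVariety K} (hc : ∑ k, c.π k ≫ c.ι k = 𝟙 c.pt) (A : X ⟶ X)
    {B : c.pt ⟶ c.pt} {b' : Matrix κ κ ℤ} {ψ : Y' ⟶ Y'} (hB : ∀ k l : κ, c.ι l ≫ B ≫ c.π k = b' k l • ψ) :
    LinearMap.trace ℤ (X ⟶ c.pt)
        ((Preadditive.leftComp c.pt A).toIntLinearMap ∘ₗ (Preadditive.rightComp X B).toIntLinearMap) =
      b'.trace *
        LinearMap.trace ℤ (X ⟶ Y') ((Preadditive.leftComp Y' A).toIntLinearMap ∘ₗ (Preadditive.rightComp X ψ).toIntLinearMap) := by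
  classical
  -- the one-point bicone on `X`
  let b₀ : Bicone (fun _ : PUnit ↦ X) :=
    { pt := X, π := fun _ ↦ 𝟙 X, ι := fun _ ↦ 𝟙 X, ι_π := fun _ _ ↦ by simp }
  have hb₀ : ∑ j, b₀.π j ≫ b₀.ι j = 𝟙 b₀.pt := by simp [b₀]
  have hA : ∀ i j : PUnit, b₀.ι j ≫ A ≫ b₀.π i = (1 : Matrix PUnit PUnit ℤ) i j • A := fun i j ↦ by
    simp [b₀]
  have h := trace_leftComp_rightComp_eq_of_blocks b₀ c hb₀ hc hA hB
  rw [Matrix.trace_one, Fintype.card_punit, Nat.cast_one, one_mul] at h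
  exact h

omit [DecidableEq ι] in
/-- **One-sided character on a power (source)**: for `A ∈ End(Y^ι)` with scalar blocks `ι_j ≫ A ≫ π_i = a_{ij} • φ` and ANY `B : X' → X'`,
`tr(f ↦ A ≫ f ≫ B | Hom(Y^ι, X')) = tr(a) · tr(f ↦ φ ≫ f ≫ B | Hom(Y, X'))`. [cite: MazurRubinSilverberg2007, Prop. 1.6 (i)]
[cite: SerreLinearRepresentations1977, §2.1 Prop. 2 (ii) and Ex. 2.4 (PDF p. 16)] -/
theorem trace_leftComp_rightComp_eq_of_blocks_left {X' : AbelianVariety K} (hb : ∑ j, b.π j ≫ b.ι j = 𝟙 b.pt)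
    {A : b.pt ⟶ b.pt} {a : Matrix ι ι ℤ} {φ : Y ⟶ Y} (hA : ∀ i j : ι, b.ι j ≫ A ≫ b.π i = a i j • φ) (B : X' ⟶ X') :
    LinearMap.trace ℤ (b.pt ⟶ X')
        ((Preadditive.leftComp X' A).toIntLinearMap ∘ₗ (Preadditive.rightComp b.pt B).toIntLinearMap) =
      a.trace *
        LinearMap.trace ℤ (Y ⟶ X') ((Preadditive.leftComp X' φ).toIntLinearMap ∘ₗ (Preadditive.rightComp Y B).toIntLinearMap) := by
  classical
  let c₀ : Bicone (fun _ : PUnit ↦ X') :=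
    { pt := X', π := fun _ ↦ 𝟙 X', ι := fun _ ↦ 𝟙 X', ι_π := fun _ _ ↦ by simp }
  have hc₀ : ∑ k, c₀.π k ≫ c₀.ι k = 𝟙 c₀.pt := by simp [c₀]
  have hB : ∀ k l : PUnit, c₀.ι l ≫ B ≫ c₀.π k = (1 : Matrix PUnit PUnit ℤ) k l • B := fun k l ↦ by
    simp [c₀]
  have h := trace_leftComp_rightComp_eq_of_blocks b c₀ hb hc₀ hA hB
  rw [Matrix.trace_one, Fintype.card_punit, Nat.cast_one, mul_one] at h
  exact h

/-- **`|G| · rk_ℤ Hom_G(X, Y' ⊗_{β'} N) = Σ_g tr n(g) · tr(f ↦ σ(g⁻¹) ≫ f ≫ β'(g) | Hom(X, Y'))`** for an arbitrary action `σ` of the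
finite group `G` on `X` and a lattice tensor as target (any field): the prequel's `|G| rk Hom_G(X, X') = Σ_g tr(f ↦ σ(g⁻¹) f ρ'(g))`
with the one-sided character. [cite: MazurRubinSilverberg2007, Prop. 1.6 (ii)] [cite: SerreLinearRepresentations1977, §2.3 Ex. 2.6 (b) and §7.3]
[cite: LangeRodriguez2022, §2.7 (2.18)] -/
theorem card_mul_finrank_equivariantHom_target_eq_sum {X : AbelianVariety K} (σ : G →* End X)
    (hc : ∑ k, c.π k ≫ c.ι k = 𝟙 c.pt)
    (hρ' : ∀ (g : G) (k l : κ), c.ι l ≫ End.asHom (ρ' g) ≫ c.π k = n g k l • End.asHom (β' g)) :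
    (Fintype.card G : ℤ) *
        Module.finrank ℤ (⨅ g : G, LinearMap.eqLocus (Preadditive.leftComp c.pt (End.asHom (σ g))).toIntLinearMap
          (Preadditive.rightComp X (End.asHom (ρ' g))).toIntLinearMap : Submodule ℤ (X ⟶ c.pt)) =
      ∑ g, (n g).trace * LinearMap.trace ℤ (X ⟶ Y')
        ((Preadditive.leftComp Y' (End.asHom (σ g⁻¹))).toIntLinearMap ∘ₗ
          (Preadditive.rightComp X (End.asHom (β' g))).toIntLinearMap) := by
  rw [card_mul_finrank_equivariantHom_eq_sum_trace σ ρ']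
  exact Finset.sum_congr rfl fun g _ ↦ trace_leftComp_rightComp_eq_of_blocks_right c hc (End.asHom (σ g⁻¹)) (hρ' g)

/-- Untwisted target: **`|G| · rk_ℤ Hom_G(X, Y' ⊗ N) = Σ_g tr n(g) · tr(f ↦ σ(g⁻¹) ≫ f | Hom(X, Y'))`** — the inner product of `χ_N` with the
character of `G` on `Hom(X, Y')` through `σ`. [cite: MazurRubinSilverberg2007, Prop. 1.6 (ii)] [cite: SerreLinearRepresentations1977, §2.3 and §7.3]
[cite: LangeRodriguez2022, §2.7 (2.18)] -/
theorem card_mul_finrank_equivariantHom_target_eq_sum_trace_leftComp {X : AbelianVariety K} (σ : G →* End X)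
    (hc : ∑ k, c.π k ≫ c.ι k = 𝟙 c.pt)
    (hρ'₁ : ∀ (g : G) (k l : κ), c.ι l ≫ End.asHom (ρ' g) ≫ c.π k = n g k l • 𝟙 Y') :
    (Fintype.card G : ℤ) *
        Module.finrank ℤ (⨅ g : G, LinearMap.eqLocus (Preadditive.leftComp c.pt (End.asHom (σ g))).toIntLinearMap
          (Preadditive.rightComp X (End.asHom (ρ' g))).toIntLinearMap : Submodule ℤ (X ⟶ c.pt)) =
      ∑ g, (n g).trace * LinearMap.trace ℤ (X ⟶ Y') (Preadditive.leftComp Y' (End.asHom (σ g⁻¹))).toIntLinearMap := by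
  rw [card_mul_finrank_equivariantHom_eq_sum_trace σ ρ']
  refine Finset.sum_congr rfl fun g _ ↦ ?_
  have e : (Preadditive.leftComp Y' (End.asHom (σ g⁻¹))).toIntLinearMap ∘ₗ (Preadditive.rightComp X (𝟙 Y')).toIntLinearMap =
      (Preadditive.leftComp Y' (End.asHom (σ g⁻¹))).toIntLinearMap :=
    LinearMap.ext fun f ↦ show End.asHom (σ g⁻¹) ≫ (f ≫ 𝟙 Y') = End.asHom (σ g⁻¹) ≫ f by rw [Category.comp_id]
  rw [trace_leftComp_rightComp_eq_of_blocks_right c hc (End.asHom (σ g⁻¹)) (hρ'₁ g), e]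

/-- **`|G| · rk_ℤ Hom_G(Y ⊗_β M, X') = Σ_g tr m(g⁻¹) · tr(f ↦ β(g⁻¹) ≫ f ≫ σ'(g) | Hom(Y, X'))`** for an arbitrary action `σ'` on `X'` and a
lattice tensor as source. [cite: MazurRubinSilverberg2007, Prop. 1.6 (ii)] [cite: SerreLinearRepresentations1977, §2.3 Ex. 2.6 (b) and §7.3]
[cite: LangeRodriguez2022, §2.7 (2.18)] -/
theorem card_mul_finrank_equivariantHom_source_eq_sum {X' : AbelianVariety K} (σ' : G →* End X')
    (hb : ∑ j, b.π j ≫ b.ι j = 𝟙 b.pt)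
    (hρ : ∀ (g : G) (i j : ι), b.ι j ≫ End.asHom (ρ g) ≫ b.π i = m g i j • End.asHom (β g)) :
    (Fintype.card G : ℤ) *
        Module.finrank ℤ (⨅ g : G, LinearMap.eqLocus (Preadditive.leftComp X' (End.asHom (ρ g))).toIntLinearMap
          (Preadditive.rightComp b.pt (End.asHom (σ' g))).toIntLinearMap : Submodule ℤ (b.pt ⟶ X')) =
      ∑ g, (m g⁻¹).trace * LinearMap.trace ℤ (Y ⟶ X')
        ((Preadditive.leftComp X' (End.asHom (β g⁻¹))).toIntLinearMap ∘ₗ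
          (Preadditive.rightComp Y (End.asHom (σ' g))).toIntLinearMap) := by
  rw [card_mul_finrank_equivariantHom_eq_sum_trace ρ σ']
  exact Finset.sum_congr rfl fun g _ ↦ trace_leftComp_rightComp_eq_of_blocks_left b hb (hρ g⁻¹) (End.asHom (σ' g))

/-- Untwisted source: **`|G| · rk_ℤ Hom_G(Y ⊗ M, X') = Σ_g tr m(g⁻¹) · tr(f ↦ f ≫ σ'(g) | Hom(Y, X'))`**.
[cite: MazurRubinSilverberg2007, Prop. 1.6 (ii)] [cite: SerreLinearRepresentations1977, §2.3 and §7.3] -/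
theorem card_mul_finrank_equivariantHom_source_eq_sum_trace_rightComp {X' : AbelianVariety K} (σ' : G →* End X')
    (hb : ∑ j, b.π j ≫ b.ι j = 𝟙 b.pt)
    (hρ₁ : ∀ (g : G) (i j : ι), b.ι j ≫ End.asHom (ρ g) ≫ b.π i = m g i j • 𝟙 Y) :
    (Fintype.card G : ℤ) *
        Module.finrank ℤ (⨅ g : G, LinearMap.eqLocus (Preadditive.leftComp X' (End.asHom (ρ g))).toIntLinearMap
          (Preadditive.rightComp b.pt (End.asHom (σ' g))).toIntLinearMap : Submodule ℤ (b.pt ⟶ X')) =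
      ∑ g, (m g⁻¹).trace * LinearMap.trace ℤ (Y ⟶ X') (Preadditive.rightComp Y (End.asHom (σ' g))).toIntLinearMap := by
  rw [card_mul_finrank_equivariantHom_eq_sum_trace ρ σ']
  refine Finset.sum_congr rfl fun g _ ↦ ?_
  have e : (Preadditive.leftComp X' (𝟙 Y)).toIntLinearMap ∘ₗ (Preadditive.rightComp Y (End.asHom (σ' g))).toIntLinearMap =
      (Preadditive.rightComp Y (End.asHom (σ' g))).toIntLinearMap :=
    LinearMap.ext fun f ↦ show 𝟙 Y ≫ (f ≫ End.asHom (σ' g)) = f ≫ End.asHom (σ' g) by rw [Category.id_comp]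
  rw [trace_leftComp_rightComp_eq_of_blocks_left b hb (hρ₁ g⁻¹) (End.asHom (σ' g)), e]

end OneSided

/-! ## §3 Invariant maps out of / into the Tate module of a lattice tensor -/

section Invariant

variable {Y : AbelianVariety K} {ι : Type} [Fintype ι] [DecidableEq ι] (b : Bicone (fun _ : ι ↦ Y))
  {G : Type} [Group G] [Fintype G] (m : G →* Matrix ι ι ℤ) (ρ : G →* End b.pt)

/-- **`rk_{ℤ_ℓ} {f : T_ℓ(Y ⊗ M) → T_ℓ Z | f ∘ T_ℓ ρ(g) = f ∀ g} = 4 · (d · dim Y) · dim Z` whenever `|G| · d = Σ_g tr m(g)`** (`d = rank M^G`;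
untwisted tensor, `ℓ` invertible in `K`): maps killing the augmentation are maps out of the coinvariants, of rank
`2 dim B_G(Y ⊗ M) · 2 dim Z` with `dim B_G(Y ⊗ M) = d · dim Y`. [cite: SerreLinearRepresentations1977, §2.3 (`(χ|1) = dim V^G`)]
[cite: MazurRubinSilverberg2007, Thm. 2.2 (iii)] [cite: KaniRosen1989, §3 Thm. B] -/
theorem finrank_tateHom_source_invariant_eq_of_card_mul_eq {Z : AbelianVariety K} (hb : ∑ j, b.π j ≫ b.ι j = 𝟙 b.pt)
    (hρ₁ : ∀ (g : G) (i j : ι), b.ι j ≫ End.asHom (ρ g) ≫ b.π i = m g i j • 𝟙 Y) (hℓ : (ℓ : K) ≠ 0) {d : ℕ}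
    (hd : (Fintype.card G : ℤ) * d = ∑ g, (m g).trace) :
    Module.finrank ℤ_[ℓ]
        (⨅ g : G, LinearMap.eqLocus (LinearMap.lcomp ℤ_[ℓ] (Z.tateModule ℓ) (tateModuleMap ℓ (End.asHom (ρ g))))
          LinearMap.id : Submodule ℤ_[ℓ] (b.pt.tateModule ℓ →ₗ[ℤ_[ℓ]] Z.tateModule ℓ)) =
      4 * (d * Y.dim) * Z.dim := by
  have h := card_mul_finrank_tateHom_source_invariant_eq ℓ (Y := Z) ρ hℓ
  simp_rw [trace_tateModuleMap_asHom_eq_trace_mul_dim ℓ b m ρ hb hρ₁ hℓ] at h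
  rw [← Finset.sum_mul] at h
  have hd' := congrArg (Int.cast : ℤ → ℤ_[ℓ]) hd
  push_cast at hd'
  rw [← hd'] at h
  have hG : (Fintype.card G : ℤ_[ℓ]) ≠ 0 := Nat.cast_ne_zero.2 Fintype.card_ne_zero
  refine Nat.cast_injective (R := ℤ_[ℓ]) (mul_left_cancel₀ hG ?_)
  push_cast at h ⊢
  linear_combination h

/-- **`rk_ℤ {f : Y ⊗ M → Z | ρ(g) ≫ f = f ∀ g} ≤ 4 · (d · dim Y) · dim Z`** for `|G| d = Σ_g tr m(g)` (any field, an auxiliary prime `ℓ`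
invertible in `K`): the invariant refinement of Mumford's bound for maps out of `Y ⊗ M` factoring through the coinvariants
`Y ⊗ M_G`. [cite: MumfordAV1970, §19 Thm. 3 and Cor. 1 (pp. 176–178)] [cite: MazurRubinSilverberg2007, Prop. 1.6 (ii)] -/
theorem finrank_hom_source_invariant_le_of_card_mul_eq {Z : AbelianVariety K} (hb : ∑ j, b.π j ≫ b.ι j = 𝟙 b.pt)
    (hρ₁ : ∀ (g : G) (i j : ι), b.ι j ≫ End.asHom (ρ g) ≫ b.π i = m g i j • 𝟙 Y) (hℓ : (ℓ : K) ≠ 0) {d : ℕ}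
    (hd : (Fintype.card G : ℤ) * d = ∑ g, (m g).trace) :
    Module.finrank ℤ (⨅ g : G, LinearMap.eqLocus (Preadditive.leftComp Z (End.asHom (ρ g))).toIntLinearMap LinearMap.id :
        Submodule ℤ (b.pt ⟶ Z)) ≤
      4 * (d * Y.dim) * Z.dim :=
  (finrank_hom_source_invariant_le ℓ ρ hℓ).trans_eq
    (finrank_tateHom_source_invariant_eq_of_card_mul_eq ℓ b m ρ hb hρ₁ hℓ hd)

/-- **`rk_{ℤ_ℓ} {f : T_ℓ X → T_ℓ(Y ⊗ M) | T_ℓ ρ(g) ∘ f = f ∀ g} = 4 · dim X · (d · dim Y)` whenever `|G| · d = Σ_g tr m(g)`** (untwisted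
tensor as TARGET, `ℓ` invertible in `K`): maps into the invariants `T_ℓ(Y ⊗ M)^G = T_ℓ Y ⊗ M^G`.
[cite: SerreLinearRepresentations1977, §2.3] [cite: MazurRubinSilverberg2007, Thm. 2.2 (iii)] [cite: KaniRosen1989, §3 Thm. B] -/
theorem finrank_tateHom_target_invariant_eq_of_card_mul_eq {X : AbelianVariety K} (hb : ∑ j, b.π j ≫ b.ι j = 𝟙 b.pt)
    (hρ₁ : ∀ (g : G) (i j : ι), b.ι j ≫ End.asHom (ρ g) ≫ b.π i = m g i j • 𝟙 Y) (hℓ : (ℓ : K) ≠ 0) {d : ℕ}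
    (hd : (Fintype.card G : ℤ) * d = ∑ g, (m g).trace) :
    Module.finrank ℤ_[ℓ]
        (⨅ g : G, LinearMap.eqLocus (LinearMap.llcomp ℤ_[ℓ] (X.tateModule ℓ) _ _ (tateModuleMap ℓ (End.asHom (ρ g))))
          LinearMap.id : Submodule ℤ_[ℓ] (X.tateModule ℓ →ₗ[ℤ_[ℓ]] b.pt.tateModule ℓ)) =
      4 * X.dim * (d * Y.dim) := by
  have h := card_mul_finrank_tateHom_target_invariant_eq ℓ (X := X) ρ hℓ
  simp_rw [trace_tateModuleMap_asHom_eq_trace_mul_dim ℓ b m ρ hb hρ₁ hℓ] at h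
  rw [← Finset.sum_mul] at h
  have hd' := congrArg (Int.cast : ℤ → ℤ_[ℓ]) hd
  push_cast at hd'
  rw [← hd'] at h
  have hG : (Fintype.card G : ℤ_[ℓ]) ≠ 0 := Nat.cast_ne_zero.2 Fintype.card_ne_zero
  refine Nat.cast_injective (R := ℤ_[ℓ]) (mul_left_cancel₀ hG ?_)
  push_cast at h ⊢
  linear_combination h

/-- **`rk_ℤ {f : X → Y ⊗ M | f ≫ ρ(g) = f ∀ g} ≤ 4 · dim X · (d · dim Y)`** for `|G| d = Σ_g tr m(g)` (any field; auxiliary `ℓ` invertible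
in `K`): maps into `Y ⊗ M` landing in the fixed part `B_G(Y ⊗ M) ∼ Y ⊗ M^G`. [cite: MumfordAV1970, §19 Thm. 3 and Cor. 1 (pp. 176–178)]
[cite: MazurRubinSilverberg2007, Prop. 1.6 (ii)] -/
theorem finrank_hom_target_invariant_le_of_card_mul_eq {X : AbelianVariety K} (hb : ∑ j, b.π j ≫ b.ι j = 𝟙 b.pt)
    (hρ₁ : ∀ (g : G) (i j : ι), b.ι j ≫ End.asHom (ρ g) ≫ b.π i = m g i j • 𝟙 Y) (hℓ : (ℓ : K) ≠ 0) {d : ℕ}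
    (hd : (Fintype.card G : ℤ) * d = ∑ g, (m g).trace) :
    Module.finrank ℤ (⨅ g : G, LinearMap.eqLocus (Preadditive.rightComp X (End.asHom (ρ g))).toIntLinearMap LinearMap.id :
        Submodule ℤ (X ⟶ b.pt)) ≤
      4 * X.dim * (d * Y.dim) :=
  (finrank_hom_target_invariant_le ℓ ρ hℓ).trans_eq
    (finrank_tateHom_target_invariant_eq_of_card_mul_eq ℓ b m ρ hb hρ₁ hℓ hd)

end Invariant

end LatticeTensor

end AbelianVariety

end Literature.AlgebraicGeometry.Motives
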